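import Mathlib
import Summits.Ventures.PercRepro2.SwOutMixedPartOrbitDefs
import Summits.Ventures.PercRepro2.SwOutSevCore

/-!
# The hull of `h` at a non-leaking point of a several-arms base (blind cell PercRepro2, night-4
g22, 2026-08-27; proofs/NIGHT4-G22.md §4)

The toggled point `toggleWR q W` of an arm-closed set; at a non-leaking point every arm vertex
lies in the hull of `h` (`armsAllR_subset_hull`), so does `u` when there is a u-arm
(`u_mem_hull_R`), and a dropped vertex lies in it iff it is attached on the side of `u`
(`p_mem_hull_iff_R`).
-/

namespace Summit.Ventures.PercRepro2

namespace MixedArms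

open Hull LocRows BigBlock

variable {V : Type*} {E : Type*} [Fintype E] [DecidableEq E]

open scoped Classical

variable {ι ρ ν κ : Type*} {ends : E → Sym2 V} {σ : Config E} {h u : V} {U : ι → Set V}
  {p : ρ → V} {Ah : ν → Set V} {arm : ν → ρ} {F : κ → Set V}

section Toggle

/-- The point with the classes inside `W` toggled: the u-arms and the u–`p r` edges with `u`, the
outside edges of `p r` with `p r`, a piece or a far arm when it lies in `W`. -/
noncomputable def toggleWR (u : V) (p : ρ → V) (Ah : ν → Set V) (F : κ → Set V)
    (q : PtR ι ρ ν κ) (W : Set V) : PtR ι ρ ν κ :=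
  (fun j => if u ∈ W then !q.1 j else q.1 j, fun i => if Ah i ⊆ W then !q.2.1 i else q.2.1 i,
    fun r => if u ∈ W then !q.2.2.1 r else q.2.2.1 r,
    fun r => if p r ∈ W then !q.2.2.2.1 r else q.2.2.2.1 r,
    fun k => if F k ⊆ W then !q.2.2.2.2 k else q.2.2.2.2 k)

end Toggle

variable (hb : MixedBaseR ends σ h u U p Ah arm F)
include hb

section Hull

variable (hup : ∀ r, ∃ e, ends e = s(u, p r)) {q : PtR ι ρ ν κ} (hqR : ¬ LeakRR arm q)
  (hqB : ¬ LeakBR arm q)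
include hup hqR hqB

omit [Fintype E] [DecidableEq E] in
/-- Every arm vertex lies in the hull of `h` at a non-leaking point. -/
theorem MixedBaseR.armsAllR_subset_hull {x : V} (hx : x ∈ armsAllR U Ah F) :
    x ∈ hull ends (mixedRealR ends u U p Ah F σ q) h := by
  have hR := hb.cluster_mixedRealR hup hqR
  have hB := hb.cluster_blue_mixedRealR hup hqB
  rcases hx with (hx | hx) | hx
  · obtain ⟨j, hj⟩ := Set.mem_iUnion.1 hx
    cases hs : q.1 j with
    | true => left; rw [hR, mem_redSetR_iff]; exact Or.inr (Or.inl ⟨j, hs, hj⟩)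
    | false => right; rw [hB, mem_redSetR_iff]; exact Or.inr (Or.inl ⟨j, by rw [flipPt_fst, hs]; rfl, hj⟩)
  · obtain ⟨i, hi⟩ := Set.mem_iUnion.1 hx
    cases ha : q.2.1 i with
    | true => left; rw [hR, mem_redSetR_iff]; exact Or.inr (Or.inr (Or.inr (Or.inr (Or.inl ⟨i, ha, hi⟩))))
    | false =>
      right; rw [hB, mem_redSetR_iff]
      exact Or.inr (Or.inr (Or.inr (Or.inr (Or.inl ⟨i, by rw [flipPt_a, ha]; rfl, hi⟩))))
  · obtain ⟨k, hk⟩ := Set.mem_iUnion.1 hx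
    cases hf : q.2.2.2.2 k with
    | true => left; rw [hR, mem_redSetR_iff]; exact Or.inr (Or.inr (Or.inr (Or.inr (Or.inr ⟨k, hf, hk⟩))))
    | false =>
      right; rw [hB, mem_redSetR_iff]
      exact Or.inr (Or.inr (Or.inr (Or.inr (Or.inr ⟨k, by rw [flipPt_f, hf]; rfl, hk⟩))))

omit [Fintype E] [DecidableEq E] in
/-- `u` lies in the hull of `h` at a non-leaking point (with a u-arm). -/
theorem MixedBaseR.u_mem_hull_R [Nonempty ι] : u ∈ hull ends (mixedRealR ends u U p Ah F σ q) h := by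
  obtain ⟨j⟩ := ‹Nonempty ι›
  cases hs : q.1 j with
  | true =>
    left; rw [hb.cluster_mixedRealR hup hqR, mem_redSetR_iff]
    exact Or.inr (Or.inr (Or.inl ⟨rfl, j, hs⟩))
  | false =>
    right; rw [hb.cluster_blue_mixedRealR hup hqB, mem_redSetR_iff]
    exact Or.inr (Or.inr (Or.inl ⟨rfl, j, by rw [flipPt_fst, hs]; rfl⟩))

omit [Fintype E] [DecidableEq E] in
/-- A dropped vertex lies in the hull of `h` iff it is attached on the side of `u`. -/
theorem MixedBaseR.p_mem_hull_iff_R (r : ρ) :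
    p r ∈ hull ends (mixedRealR ends u U p Ah F σ q) h ↔
      ((∃ j, q.1 j = true) ∧ q.2.2.1 r = true) ∨ ((∃ j, q.1 j = false) ∧ q.2.2.1 r = false) := by
  have hph : ∀ r, p r ≠ h := fun r => (hb.hne_hp r).symm
  have hpu : ∀ r, p r ≠ u := fun r => (hb.hne_up r).symm
  have hkey : ∀ (q' : PtR ι ρ ν κ), p r ∈ redSetR h u U p Ah F q' ↔
      (∃ j, q'.1 j = true) ∧ q'.2.2.1 r = true := by
    intro q'
    rw [mem_redSetR_iff]
    constructor
    · rintro (h' | ⟨j, -, hx⟩ | ⟨h', -⟩ | ⟨r', hr', hs, hr⟩ | ⟨i, -, hx⟩ | ⟨k, -, hx⟩)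
      · exact absurd h' (hph r)
      · exact absurd hx (hb.p_notMem_U r j)
      · exact absurd h' (hpu r)
      · rw [hb.p_inj hr']; exact ⟨hs, hr⟩
      · exact absurd hx (hb.p_notMem_Ah r i)
      · exact absurd hx (hb.p_notMem_F r k)
    · rintro ⟨hs, hr⟩
      exact Or.inr (Or.inr (Or.inr (Or.inl ⟨r, rfl, hs, hr⟩)))
  constructor
  · rintro (hx | hx)
    · rw [hb.cluster_mixedRealR hup hqR, hkey] at hx
      exact Or.inl hx
    · rw [hb.cluster_blue_mixedRealR hup hqB, hkey] at hx
      obtain ⟨⟨j, hj⟩, hr⟩ := hx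
      rw [flipPt_fst] at hj
      rw [flipPt_uP] at hr
      exact Or.inr ⟨⟨j, by simpa using hj⟩, by simpa using hr⟩
  · rintro (hx | ⟨⟨j, hj⟩, hr⟩)
    · left; rw [hb.cluster_mixedRealR hup hqR, hkey]; exact hx
    · right; rw [hb.cluster_blue_mixedRealR hup hqB, hkey]
      exact ⟨⟨j, by rw [flipPt_fst, hj]; rfl⟩, by rw [flipPt_uP, hr]; rfl⟩

end Hull

end MixedArms

end Summit.Ventures.PercRepro2
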